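import Summits.Ventures.Crystal3D.Theorems.StickyWulffConstantPolycrystalWulffBoundSubfamilyFacetSums

/-!
# `PolycrystalWulffBound`: the interface of two cell families is the CROSS-CELL facet sum

Route `StickyWulffConstant` of the venture `Summits/Ventures/Crystal3D`, crux `PolycrystalWulffBound`
(item `stmt-Ventures-19482`), second prover lane; step 4(b) of the P-BRIDGE memo (evidence #10).
For a family of cells satisfying clause (B)'s hypotheses (e.g. the refinement
`exists_disjoint_polytope_refinement_full` of a polyhedral texture) and two DISJOINT index sets
`sA, sB` (the cells of two grains), the crux's interface expression
`per K A + per K B − per K (A ∪ B)` (`= 2 ι_K(A, B)`), `A = ⋃_{sA} Q_j`, `B = ⋃_{sB} Q_j`, equals the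
sum over CROSS pairs `a ∈ sA, b ∈ sB` of clause (B)'s facet term (oriented by the smaller index):

* `pair_block_identity` — the pure Finset algebra: for any kernel `T` and disjoint `sA, sB`,
  `U(sA ∪ sB) − U(sA) − U(sB) = Σ_{a ∈ sA} Σ_{b ∈ sB} (if a < b then T a b else T b a)` where
  `U(s) = Σ_{a,b ∈ s, a<b} T a b`;
* `per_add_per_sub_per_union_eq_crossSum_of_polytopeCalculus` — `PolytopeCalculus →` the interface
  formula above (via `per_biUnion_eq_of_polytopeCalculus` three times).
Conditional only on the registered 19483 stub statement BY NAME.  WHAT THIS IS NOT: the facet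
calculus; the identification of a texture's grains with cell families is
`exists_disjoint_polytope_refinement_full` + `per_congr_ae` (…PolyFacetSums), not repeated here.
-/

noncomputable section

namespace Summit.Ventures.Crystal3D.Theorems

open MeasureTheory Set Finset
open scoped RealInnerProductSpace ENNReal
open Summit.Ventures.Crystal3D.Cruxes.TextureLiminf.TexShadow

/-- **Block identity for ordered-pair sums.** For a kernel `T` on `Fin k` and disjoint `sA, sB`:
the `a < b` pair sum over `sA ∪ sB` minus the pair sums over `sA` and over `sB` is the CROSS sum
`Σ_{a ∈ sA} Σ_{b ∈ sB} (if a < b then T a b else T b a)`. -/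
theorem pair_block_identity {k : ℕ} (T : Fin k → Fin k → ℝ) {sA sB : Finset (Fin k)}
    (h : Disjoint sA sB) :
    (∑ a ∈ sA ∪ sB, ∑ b ∈ sA ∪ sB, if a < b then T a b else 0) -
      (∑ a ∈ sA, ∑ b ∈ sA, if a < b then T a b else 0) -
      (∑ a ∈ sB, ∑ b ∈ sB, if a < b then T a b else 0) =
      ∑ a ∈ sA, ∑ b ∈ sB, (if a < b then T a b else T b a) := by
  -- expand the union sums into four blocks
  have hout : (∑ a ∈ sA ∪ sB, ∑ b ∈ sA ∪ sB, if a < b then T a b else (0 : ℝ)) =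
      (∑ a ∈ sA, ∑ b ∈ sA, if a < b then T a b else 0) +
      (∑ a ∈ sA, ∑ b ∈ sB, if a < b then T a b else 0) +
      ((∑ a ∈ sB, ∑ b ∈ sA, if a < b then T a b else 0) +
      (∑ a ∈ sB, ∑ b ∈ sB, if a < b then T a b else 0)) := by
    rw [Finset.sum_union h]
    simp_rw [Finset.sum_union h]
    rw [Finset.sum_add_distrib, Finset.sum_add_distrib]
  rw [hout]
  -- the BA block, with summation order swapped
  have hBA : (∑ a ∈ sB, ∑ b ∈ sA, if a < b then T a b else (0 : ℝ)) =
      ∑ a ∈ sA, ∑ b ∈ sB, if b < a then T b a else 0 := by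
    rw [Finset.sum_comm]
  rw [hBA]
  -- combine AB and the swapped BA termwise
  have hcomb : (∑ a ∈ sA, ∑ b ∈ sB, if a < b then T a b else (0 : ℝ)) +
      (∑ a ∈ sA, ∑ b ∈ sB, if b < a then T b a else 0) =
      ∑ a ∈ sA, ∑ b ∈ sB, (if a < b then T a b else T b a) := by
    rw [← Finset.sum_add_distrib]
    refine Finset.sum_congr rfl fun a ha => ?_
    rw [← Finset.sum_add_distrib]
    refine Finset.sum_congr rfl fun b hb => ?_
    have hab : a ≠ b := fun hab => Finset.disjoint_left.1 h ha (hab ▸ hb)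
    rcases lt_or_gt_of_ne hab with hlt | hgt
    · simp [hlt, lt_asymm hlt]
    · simp [hgt, lt_asymm hgt]
  rw [← hcomb]
  ring

/-- **The interface of two disjoint cell families is the cross-cell facet sum.** Assuming
`PolytopeCalculus`: for bounded, pairwise disjoint open polytopes `Q_j = polytope (H j)` (`j : Fin k`)
with unit common-plane normals `ν` and disjoint index sets `sA, sB`,
`per K (⋃_{sA} Q) + per K (⋃_{sB} Q) − per K (⋃_{sA ∪ sB} Q)
   = Σ_{a ∈ sA} Σ_{b ∈ sB} crossTerm (min-oriented)`,
where the cross term of the pair is clause (B)'s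
`(h_K(ν a b) + h_K(−ν a b)) · facetArea (Q̄_a ∩ Q̄_b) (ν a b)` taken at `(a, b)` if `a < b` and at
`(b, a)` otherwise.  (Twice the crux's `ι_K` of the two unions.) -/
theorem per_add_per_sub_per_union_eq_crossSum_of_polytopeCalculus (hPC : PolytopeCalculus)
    {K : Set E3} (hK : IsCompact K) (hKc : Convex ℝ K) (h0 : (0 : E3) ∈ K) {k : ℕ}
    (H : Fin k → Finset (E3 × ℝ)) (ν : Fin k → Fin k → E3)
    (hbd : ∀ j, Bornology.IsBounded (polytope (H j)))
    (hdisj : ∀ j j', j ≠ j' → Disjoint (polytope (H j)) (polytope (H j')))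
    (hplane : ∀ j j', j ≠ j' → ‖ν j j'‖ = 1 ∧ ∃ b : ℝ,
      closure (polytope (H j)) ∩ closure (polytope (H j')) ⊆ {x | ⟪ν j j', x⟫ = b})
    {sA sB : Finset (Fin k)} (hAB : Disjoint sA sB) :
    per K (⋃ j ∈ sA, polytope (H j)) + per K (⋃ j ∈ sB, polytope (H j)) -
        per K (⋃ j ∈ sA ∪ sB, polytope (H j)) =
      ∑ a ∈ sA, ∑ b ∈ sB,
        (if a < b then (supportFn K (ν a b) + supportFn K (-ν a b)) *
            facetArea (closure (polytope (H a)) ∩ closure (polytope (H b))) (ν a b)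
          else (supportFn K (ν b a) + supportFn K (-ν b a)) *
            facetArea (closure (polytope (H b)) ∩ closure (polytope (H a))) (ν b a)) := by
  set T : Fin k → Fin k → ℝ := fun a b => (supportFn K (ν a b) + supportFn K (-ν a b)) *
    facetArea (closure (polytope (H a)) ∩ closure (polytope (H b))) (ν a b) with hT
  have hA := per_biUnion_eq_of_polytopeCalculus hPC hK hKc h0 H ν hbd hdisj hplane sA
  have hB := per_biUnion_eq_of_polytopeCalculus hPC hK hKc h0 H ν hbd hdisj hplane sB
  have hU := per_biUnion_eq_of_polytopeCalculus hPC hK hKc h0 H ν hbd hdisj hplane (sA ∪ sB)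
  have hblock := pair_block_identity T hAB
  have hsumU : (∑ j ∈ sA ∪ sB, per K (polytope (H j))) =
      (∑ j ∈ sA, per K (polytope (H j))) + ∑ j ∈ sB, per K (polytope (H j)) :=
    Finset.sum_union hAB
  -- the goal's right-hand side is the cross sum of `T`
  have hrhs : (∑ a ∈ sA, ∑ b ∈ sB,
        (if a < b then (supportFn K (ν a b) + supportFn K (-ν a b)) *
            facetArea (closure (polytope (H a)) ∩ closure (polytope (H b))) (ν a b)
          else (supportFn K (ν b a) + supportFn K (-ν b a)) *
            facetArea (closure (polytope (H b)) ∩ closure (polytope (H a))) (ν b a))) =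
      ∑ a ∈ sA, ∑ b ∈ sB, (if a < b then T a b else T b a) := by
    rfl
  rw [hrhs, ← hblock, hA, hB, hU, hsumU]
  ring

end Summit.Ventures.Crystal3D.Theorems

end
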